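/-
COR-CM (cell pub-hodgecm2, stage 2 of the Hodge ladder) — count-neutral KERNEL COMBINATORICS «index-two descent of abstract CM types: the mixed faces span the
bi-marginal-zero lattice» (seat prover-pub-hodgecm2-b23-g41-0, binder prover b23, gen 41; claim QUARTIC-TRANSPORT, CLAIM-ADDENDUM #1 «INDEX-TWO DESCENT»,
HOME/INBOX.md l.10136; blanket `Census/IndexTwoDescent*` l.10149).
One bookkeeping definition with body (`sqVec`) + theorems, on top of parts I/II (`Census/IndexTwoDescent{Dictionary,Hodge}.lean`), this seat's deviation weight
(`Census/ComplementFacesWeight.lean`: `wt`, `wt_oflipCM_of_notMem`, `eq_of_wt_eq_zero`) and the intrinsic currency, all BY NAME; no `decide`, no certificate,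
no named fact, no `sorry`; `Interfaces.lean` (C1), every E term, B01, `Transposition/*`, `PortJoin/*` untouched.
HONEST FRAMING: `HC_CM` is NOT proved, here or anywhere in the tree; nothing here is a period, a count of record or a headline.
T5: n/a-class (hypothesis binders: `c ∈ H`, `c * c = 1`, `c` central, `x ∉ H`, `H.index = 2`, vanishing of marginals); checker: self, 2026-08-23.
-/
import Summits.HodgeConjecture.CorCM.Census.IndexTwoDescentHodge
import Summits.HodgeConjecture.CorCM.Census.ComplementFacesWeight

/-!
# Index-two descent of abstract CM types, IV: the bi-marginal-zero lattice is the span of the mixed faces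

Parts I–II: along an index-two subgroup `H ∋ c` (`c` central, `x ∉ H`) the types of `(G, c)` are pairs of types of `(H, c)` and
`hodgeSpan G = {y | marg₀ y, marg₁ y ∈ hodgeSpan H}`; a MIXED face (one place in `H`, one in `xH`) has both marginals zero.  Here the converse:

* §1 (any finite group `K` with an involution `c'`): in `ℤ[CMF K c' × CMF K c']` the second differences
  `sqVec a a' b b' = e_{(a,b)} − e_{(a',b)} − e_{(a,b')} + e_{(a',b')}` with `a' = a^{(t)}`, `b' = b^{(t')}` SINGLE FLIPS span every vector with both
  marginals zero (`mem_span_adjSq_of_marginals_eq_zero`; telescoping along flip paths, measured by the deviation weight `wt` of `Census/ComplementFacesWeight`);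
* §2 under `trPair` these adjacent second differences are exactly the mixed faces `gface (glue a b) t (x·t')` (`trPair_sqVec_adj`), whence
  **`span_mixed_eq`**: `ℤ⟨mixed faces⟩ = ker marg₀ ⊓ ker marg₁` — the bi-marginal-zero lattice `Z` of seat b09's octic road map
  (`HOME/pub-hodgecm2-b09/lean-g32/QUARTIC-TWIST.md` PART VI (3): «Z is the ℤ-span of mixed faces (telescoping)») in the intrinsic currency, for every
  index-two subgroup through `c`.  What remains for a generation theorem along this road is an ORBIT-EFFICIENT `ℤ[G]`-generating set of `Z` (b09: `r − 1` orbits).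

## References
* [Pohlmann1968] H. Pohlmann, Algebraic cycles on abelian varieties of complex multiplication type, Ann. of Math. 88 (1968), Thm 1.
-/

namespace Summit.HodgeConjecture.CorCM.Census.IndexTwoDescent

open Finset
open Summit.HodgeConjecture.CorCM.Prior.AllgGroup.RfwfAllgGroup
open Summit.HodgeConjecture.CorCM.Census.BlockParity
open Summit.HodgeConjecture.CorCM.Census.ComplementFaces (wt wt_oflipCM_of_notMem eq_of_wt_eq_zero)

noncomputable section

/-! ## §1 Adjacent second differences span the bi-marginal-zero vectors of `ℤ[T × T]` -/

section Pairs

variable {K : Type*} [Group K] [Fintype K] [DecidableEq K] {c' : K}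

/-- **The second difference** `e_{(a,b)} − e_{(a',b)} − e_{(a,b')} + e_{(a',b')}` in `ℤ[T × T]`, `T = CMF K c'`. [folklore] -/
def sqVec (a a' b b' : CMF K c') : CMF K c' × CMF K c' →₀ ℤ :=
  Finsupp.single (a, b) 1 - Finsupp.single (a', b) 1 - Finsupp.single (a, b') 1 + Finsupp.single (a', b') 1

/-- Telescoping in the first variable. [folklore] -/
theorem sqVec_add_sqVec_left (a a' a'' b b' : CMF K c') : sqVec a a' b b' + sqVec a' a'' b b' = sqVec a a'' b b' := by
  unfold sqVec; abel

/-- Telescoping in the second variable. [folklore] -/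
theorem sqVec_add_sqVec_right (a a' b b' b'' : CMF K c') : sqVec a a' b b' + sqVec a a' b' b'' = sqVec a a' b b'' := by
  unfold sqVec; abel

/-- Degenerate first variable. [folklore] -/
theorem sqVec_self_left (a b b' : CMF K c') : sqVec a a b b' = 0 := by
  unfold sqVec; abel

/-- Degenerate second variable. [folklore] -/
theorem sqVec_self_right (a a' b : CMF K c') : sqVec a a' b b = 0 := by
  unfold sqVec; abel

/-- **The adjacent second differences**: `sqVec a a^{(t)} b b^{(t')}` (single flips in both variables). [folklore] -/
def adjSqSet (hc2' : c' * c' = 1) : Set (CMF K c' × CMF K c' →₀ ℤ) :=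
  {z | ∃ (a b : CMF K c') (t t' : K), z = sqVec a (oflipCM c' hc2' t a) b (oflipCM c' hc2' t' b)}

/-- **Flip paths**: from `a ≠ a₀` one flip of `a` lowers the deviation weight `wt a₀ a = #(a₀ ∖ a)`. [folklore] -/
theorem exists_oflipCM_wt_lt (hc2' : c' * c' = 1) {a₀ a : CMF K c'} (h : a ≠ a₀) : ∃ t : K, wt c' a₀ (oflipCM c' hc2' t a) < wt c' a₀ a := by
  have hpos : 0 < wt c' a₀ a := by
    refine Nat.pos_of_ne_zero fun h0 => h (eq_of_wt_eq_zero c' h0)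
  obtain ⟨d, hd⟩ := Finset.card_pos.mp hpos
  rw [Finset.mem_sdiff] at hd
  exact ⟨d, by have := wt_oflipCM_of_notMem c' hc2' hd.1 hd.2; omega⟩

/-- Claim A: with ADJACENT second variables, every first-variable difference telescopes into adjacent second differences. [folklore] -/
theorem sqVec_adj_mem_span (hc2' : c' * c' = 1) (b : CMF K c') (t' : K) :
    ∀ (n : ℕ) (a a₀ : CMF K c'), wt c' a₀ a = n → sqVec a a₀ b (oflipCM c' hc2' t' b) ∈ Submodule.span ℤ (adjSqSet hc2') := by
  intro n
  induction n using Nat.strong_induction_on with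
  | h n ih =>
    intro a a₀ hn
    by_cases h : a = a₀
    · rw [h, sqVec_self_left]; exact Submodule.zero_mem _
    · obtain ⟨t, ht⟩ := exists_oflipCM_wt_lt hc2' h
      rw [← sqVec_add_sqVec_left a (oflipCM c' hc2' t a) a₀]
      exact Submodule.add_mem _ (Submodule.subset_span ⟨a, b, t, t', rfl⟩) (ih _ (hn ▸ ht) _ _ rfl)

/-- Claim B: EVERY second difference `sqVec a a₀ b b₀` telescopes into adjacent ones. [folklore] -/
theorem sqVec_mem_span (hc2' : c' * c' = 1) (a a₀ : CMF K c') :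
    ∀ (n : ℕ) (b b₀ : CMF K c'), wt c' b₀ b = n → sqVec a a₀ b b₀ ∈ Submodule.span ℤ (adjSqSet hc2') := by
  intro n
  induction n using Nat.strong_induction_on with
  | h n ih =>
    intro b b₀ hn
    by_cases h : b = b₀
    · rw [h, sqVec_self_right]; exact Submodule.zero_mem _
    · obtain ⟨t', ht'⟩ := exists_oflipCM_wt_lt hc2' h
      rw [← sqVec_add_sqVec_right a a₀ b (oflipCM c' hc2' t' b) b₀]
      exact Submodule.add_mem _ (sqVec_adj_mem_span hc2' b t' _ a a₀ rfl) (ih _ (hn ▸ ht') _ _ rfl)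

/-- The base-point reduction: `z − (z pushed to the row of b₀) − (z pushed to the column of a₀) + (Σ z)·e_{(a₀,b₀)}` is a combination of second
differences through `(a₀, b₀)`. [folklore] -/
theorem sub_reduction_mem_span (a₀ b₀ : CMF K c') (z : CMF K c' × CMF K c' →₀ ℤ) :
    z - (Finsupp.mapDomain (fun p : CMF K c' × CMF K c' => (p.1, b₀)) z + Finsupp.mapDomain (fun p : CMF K c' × CMF K c' => (a₀, p.2)) z -
      (z.sum fun _ n => n) • Finsupp.single (a₀, b₀) 1) ∈
      Submodule.span ℤ {w | ∃ a b : CMF K c', w = sqVec a a₀ b b₀} := by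
  induction z using Finsupp.induction_linear with
  | zero => simp
  | add z w hz hw =>
    rw [Finsupp.mapDomain_add, Finsupp.mapDomain_add, Finsupp.sum_add_index' (fun _ => rfl) (fun _ _ _ => rfl)]
    have e : z + w - (Finsupp.mapDomain (fun p : CMF K c' × CMF K c' => (p.1, b₀)) z + Finsupp.mapDomain (fun p => (p.1, b₀)) w +
        (Finsupp.mapDomain (fun p : CMF K c' × CMF K c' => (a₀, p.2)) z + Finsupp.mapDomain (fun p => (a₀, p.2)) w) -
        ((z.sum fun _ n => n) + w.sum fun _ n => n) • Finsupp.single (a₀, b₀) 1) =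
      (z - (Finsupp.mapDomain (fun p : CMF K c' × CMF K c' => (p.1, b₀)) z + Finsupp.mapDomain (fun p => (a₀, p.2)) z -
        (z.sum fun _ n => n) • Finsupp.single (a₀, b₀) 1)) +
      (w - (Finsupp.mapDomain (fun p : CMF K c' × CMF K c' => (p.1, b₀)) w + Finsupp.mapDomain (fun p => (a₀, p.2)) w -
        (w.sum fun _ n => n) • Finsupp.single (a₀, b₀) 1)) := by
      rw [add_smul]; abel
    rw [e]
    exact Submodule.add_mem _ hz hw
  | single p n =>
    rw [Finsupp.mapDomain_single, Finsupp.mapDomain_single, Finsupp.sum_single_index rfl]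
    have e : Finsupp.single p n - (Finsupp.single (p.1, b₀) n + Finsupp.single (a₀, p.2) n - n • Finsupp.single (a₀, b₀) (1 : ℤ)) =
        n • sqVec p.1 a₀ p.2 b₀ := by
      simp only [sqVec, smul_add, smul_sub, Finsupp.smul_single_one]
      abel
    rw [e]
    exact Submodule.smul_mem _ n (Submodule.subset_span ⟨p.1, p.2, rfl⟩)

/-- **Vectors of `ℤ[T × T]` with both marginals zero are combinations of adjacent second differences.** [folklore] -/
theorem mem_span_adjSq_of_marginals_eq_zero (hc2' : c' * c' = 1) (a₀ b₀ : CMF K c') {z : CMF K c' × CMF K c' →₀ ℤ}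
    (h0 : Finsupp.mapDomain Prod.fst z = 0) (h1 : Finsupp.mapDomain Prod.snd z = 0) : z ∈ Submodule.span ℤ (adjSqSet hc2') := by
  have hz := sub_reduction_mem_span a₀ b₀ z
  have e0 : Finsupp.mapDomain (fun p : CMF K c' × CMF K c' => (p.1, b₀)) z = 0 := by
    rw [show (fun p : CMF K c' × CMF K c' => (p.1, b₀)) = (fun a => (a, b₀)) ∘ Prod.fst from rfl, Finsupp.mapDomain_comp, h0,
      Finsupp.mapDomain_zero]
  have e1 : Finsupp.mapDomain (fun p : CMF K c' × CMF K c' => (a₀, p.2)) z = 0 := by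
    rw [show (fun p : CMF K c' × CMF K c' => (a₀, p.2)) = (fun b => (a₀, b)) ∘ Prod.snd from rfl, Finsupp.mapDomain_comp, h1,
      Finsupp.mapDomain_zero]
  have es : (z.sum fun _ n => n) = 0 := by
    have h := Finsupp.sum_mapDomain_index (f := Prod.fst) (s := z) (h := fun (_ : CMF K c') (n : ℤ) => n) (fun _ => rfl)
      (fun _ _ _ => rfl)
    rw [h0, Finsupp.sum_zero_index] at h
    exact h.symm
  rw [e0, e1, es, zero_add, zero_smul, sub_zero, sub_zero] at hz
  refine Submodule.span_le.mpr ?_ hz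
  rintro _ ⟨a, b, rfl⟩
  exact sqVec_mem_span hc2' a a₀ _ b b₀ rfl

end Pairs

/-! ## §2 The mixed faces of `(G, c)` span the bi-marginal-zero lattice -/

variable {G : Type*} [Group G] [Fintype G] [DecidableEq G] {c : G}
variable {H : Subgroup G} [DecidablePred (· ∈ H)]

/-- **The mixed faces**: faces of `(G, c)` with one place in `H` and one in `xH`. [folklore] -/
def mixedSet (c : G) (hc2 : c * c = 1) (H : Subgroup G) (x : G) : Set (CMF G c →₀ ℤ) :=
  {y | ∃ (Ψ : CMF G c) (t t' : H), y = gface c hc2 Ψ (t : G) (x * (t' : G))}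

omit [DecidablePred (· ∈ H)] in
/-- Mixed faces are faces. [folklore] -/
theorem mixedSet_subset_gfaceSet (hcH : c ∈ H) (hc2 : c * c = 1) {x : G} (hx : x ∉ H) : mixedSet c hc2 H x ⊆ gfaceSet G c hc2 := by
  rintro _ ⟨Ψ, t, t', rfl⟩
  exact ⟨Ψ, t, x * (t' : G), mul_coe_not_mem_orb_coe hcH hx t t', rfl⟩

/-- **Under `trPair` an adjacent second difference is a mixed face**: `trPair (sqVec a a^{(t)} b b^{(t')}) = gface (glue a b) t (x·t')`. [folklore] -/
theorem trPair_sqVec_adj (hcH : c ∈ H) (hcen : ∀ g : G, g * c = c * g) (hc2 : c * c = 1) (hH : H.index = 2) {x : G} (hx : x ∉ H)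
    (a b : CMF H ⟨c, hcH⟩) (t t' : H) :
    trPair hcH hcen hH hx (sqVec a (oflipCM (⟨c, hcH⟩ : H) (csub_mul_csub hcH hc2) t a) b
        (oflipCM (⟨c, hcH⟩ : H) (csub_mul_csub hcH hc2) t' b)) =
      gface c hc2 (glue hcH hcen hH hx a b) (t : G) (x * (t' : G)) := by
  apply (trPair hcH hcen hH hx).symm.injective
  rw [LinearEquiv.symm_apply_apply, gface, sqVec]
  simp only [map_add, map_sub, trPair_symm_single, res₀_oflipCM_coe, res₁_oflipCM_coe hcH hcen hc2 hx, res₀_oflipCM_mul hcH hcen hc2 hx,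
    res₁_oflipCM_mul, res₀_glue, res₁_glue]
  abel

/-- The marginals through `trPair`: `marg₀ ∘ trPair = (Prod.fst)_*`. [folklore] -/
theorem marg₀_trPair (hcH : c ∈ H) (hcen : ∀ g : G, g * c = c * g) (hH : H.index = 2) {x : G} (hx : x ∉ H)
    (z : CMF H ⟨c, hcH⟩ × CMF H ⟨c, hcH⟩ →₀ ℤ) : marg₀ hcH (trPair hcH hcen hH hx z) = Finsupp.mapDomain Prod.fst z := by
  induction z using Finsupp.induction_linear with
  | zero => simp
  | add z w hz hw => rw [map_add, map_add, Finsupp.mapDomain_add, hz, hw]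
  | single p n => rw [marg₀_trPair_single, Finsupp.mapDomain_single]

/-- The marginals through `trPair`: `marg₁ ∘ trPair = (Prod.snd)_*`. [folklore] -/
theorem marg₁_trPair (hcH : c ∈ H) (hcen : ∀ g : G, g * c = c * g) (hH : H.index = 2) {x : G} (hx : x ∉ H)
    (z : CMF H ⟨c, hcH⟩ × CMF H ⟨c, hcH⟩ →₀ ℤ) : marg₁ hcH hcen x (trPair hcH hcen hH hx z) = Finsupp.mapDomain Prod.snd z := by
  induction z using Finsupp.induction_linear with
  | zero => simp
  | add z w hz hw => rw [map_add, map_add, Finsupp.mapDomain_add, hz, hw]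
  | single p n => rw [marg₁_trPair_single, Finsupp.mapDomain_single]

/-- **Bi-marginal-zero vectors are combinations of mixed faces.** [folklore] -/
theorem mem_span_mixed_of_marg_eq_zero (hcH : c ∈ H) (hcen : ∀ g : G, g * c = c * g) (hc2 : c * c = 1) (hH : H.index = 2) {x : G} (hx : x ∉ H)
    (Ψ₀ : CMF G c) {y : CMF G c →₀ ℤ} (h0 : marg₀ hcH y = 0) (h1 : marg₁ hcH hcen x y = 0) :
    y ∈ Submodule.span ℤ (mixedSet c hc2 H x) := by
  obtain ⟨z, rfl⟩ : ∃ z, trPair hcH hcen hH hx z = y := ⟨(trPair hcH hcen hH hx).symm y, LinearEquiv.apply_symm_apply _ _⟩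
  rw [marg₀_trPair] at h0
  rw [marg₁_trPair] at h1
  have hz := mem_span_adjSq_of_marginals_eq_zero (csub_mul_csub hcH hc2) (res₀ hcH Ψ₀) (res₁ hcH hcen x Ψ₀) h0 h1
  have hmap : Submodule.map (trPair hcH hcen hH hx : _ →ₗ[ℤ] (CMF G c →₀ ℤ)) (Submodule.span ℤ (adjSqSet (csub_mul_csub hcH hc2))) ≤
      Submodule.span ℤ (mixedSet c hc2 H x) := by
    rw [Submodule.map_span, Submodule.span_le]
    rintro _ ⟨_, ⟨a, b, t, t', rfl⟩, rfl⟩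
    rw [LinearEquiv.coe_coe, trPair_sqVec_adj hcH hcen hc2 hH hx]
    exact Submodule.subset_span ⟨_, t, t', rfl⟩
  exact hmap (Submodule.mem_map_of_mem hz)

/-- **THE BI-MARGINAL-ZERO LATTICE IS THE SPAN OF THE MIXED FACES**: `ℤ⟨mixed faces⟩ = ker marg₀ ⊓ ker marg₁`, for every central involution `c`,
every subgroup `H ∋ c` of index two and every `x ∉ H`. [folklore] -/
theorem span_mixed_eq (hcH : c ∈ H) (hcen : ∀ g : G, g * c = c * g) (hc2 : c * c = 1) (hH : H.index = 2) {x : G} (hx : x ∉ H) (Ψ₀ : CMF G c) :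
    Submodule.span ℤ (mixedSet c hc2 H x) = LinearMap.ker (marg₀ hcH) ⊓ LinearMap.ker (marg₁ hcH hcen x) := by
  refine le_antisymm (Submodule.span_le.mpr ?_) fun y hy => ?_
  · rintro _ ⟨Ψ, t, t', rfl⟩
    exact ⟨LinearMap.mem_ker.mpr (marg₀_gface_coe_mul hcH hcen hc2 hx Ψ t t'), LinearMap.mem_ker.mpr (marg₁_gface_coe_mul hcH hcen hc2 hx Ψ t t')⟩
  · exact mem_span_mixed_of_marg_eq_zero hcH hcen hc2 hH hx Ψ₀ (LinearMap.mem_ker.mp hy.1) (LinearMap.mem_ker.mp hy.2)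

/-- Corollary: the bi-marginal-zero lattice lies in the face span (hence in `hodgeSpan`). [folklore] -/
theorem ker_inf_ker_le_span_gfaceSet (hcH : c ∈ H) (hcen : ∀ g : G, g * c = c * g) (hc2 : c * c = 1) (hH : H.index = 2) {x : G} (hx : x ∉ H)
    (Ψ₀ : CMF G c) : LinearMap.ker (marg₀ hcH) ⊓ LinearMap.ker (marg₁ hcH hcen x) ≤ Submodule.span ℤ (gfaceSet G c hc2) := by
  rw [← span_mixed_eq hcH hcen hc2 hH hx Ψ₀]
  exact Submodule.span_mono (mixedSet_subset_gfaceSet hcH hc2 hx)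

end

end Summit.HodgeConjecture.CorCM.Census.IndexTwoDescent
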